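import Mathlib.Analysis.LocallyConvex.WithSeminorms
import Mathlib.LinearAlgebra.Multilinear.Curry
import Mathlib.Topology.Baire.Lemmas
import Mathlib.Analysis.Normed.Module.Basic
import HarnessLib

/-!
# The uniform boundedness principle (Banach–Steinhaus) for families of multilinear maps on Baire
# locally convex spaces

Topic `Literature/Analysis/FunctionSpaces` (next to `SchwartzComplete.lean`, `ContDiffMapSupportedInComplete.lean`,
which make Mathlib's LINEAR `WithSeminorms.banach_steinhaus` available on `𝓢` and `𝓓_K`).  For MULTILINEAR families
Mathlib has nothing; the tree's `ContinuumLegGivenGap…StubBilinearUBP` treats bilinear forms on Banach spaces by currying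
operator norms, which is not available on Fréchet spaces.  Here: let `E₀, …, E_{n−1}` be real topological vector spaces
whose topologies are given by countable families of seminorms `p i : κ i → Seminorm ℝ (E i)` (`WithSeminorms`) and which
are Baire (e.g. Fréchet spaces: `𝓢`, `𝓓_K`, closed subspaces of those), and `T k : MultilinearMap ℝ E G` (`k ∈ ι`,
`G` normed) continuous and POINTWISE BOUNDED.  Then

* `MultilinearMap.exists_seminorm_bound_of_pointwise_bdd` — they are UNIFORMLY bounded by one product of continuous
  seminorms: `∃ (s : ∀ i, Finset (κ i)) C, ∀ k x, ‖T k x‖ ≤ C · ∏ᵢ (∑_{m ∈ s i} p i m) (x i)` (Bourbaki's theorem;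
  proof by induction on `n`, fixing the last variable: the inductive bound holds on closed sets covering the last factor,
  Baire gives an interior point, multilinearity in the last slot spreads the bound);
* `MultilinearMap.tendsto_apply_of_pointwise_tendsto` — consequently a pointwise convergent SEQUENCE of such maps
  converges along convergent sequences of arguments: `T k (x k) → T∞ x₀` whenever `T k x → T∞ x` for all `x` and
  `x k → x₀` (joint continuity of the limiting process; the form used to move test functions with the lattice in
  continuum-limit arguments).

References: N. Bourbaki, *Espaces vectoriels topologiques*, Ch. III §5 (Th. de Banach–Steinhaus pour les applications
multilinéaires; EVT III.36 in the 1981 edition); W. Rudin, *Functional Analysis* (2nd ed.), Thm. 2.17 (bilinear case).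
Mathlib only; no definitions. [folklore]
-/

noncomputable section

open Filter Topology Set Function
open scoped BigOperators

namespace Literature.Analysis.FunctionSpaces

universe u v w uι

/-- Continuity of `y ↦ T (Fin.snoc x' y)` for a continuous map on the product. [folklore] -/
theorem continuous_comp_snoc_right {n : ℕ} {E : Fin (n + 1) → Type u} [∀ i, TopologicalSpace (E i)] {G : Type w}
    [TopologicalSpace G] {T : (∀ i, E i) → G} (hT : Continuous T) (x' : ∀ i : Fin n, E i.castSucc) :
    Continuous fun y : E (Fin.last n) => T (Fin.snoc x' y) :=
  hT.comp (continuous_const.finSnoc continuous_id)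

/-- Continuity of `x' ↦ T (Fin.snoc x' y)`. [folklore] -/
theorem continuous_comp_snoc_left {n : ℕ} {E : Fin (n + 1) → Type u} [∀ i, TopologicalSpace (E i)] {G : Type w}
    [TopologicalSpace G] {T : (∀ i, E i) → G} (hT : Continuous T) (y : E (Fin.last n)) :
    Continuous fun x' : ∀ i : Fin n, E i.castSucc => T (Fin.snoc x' y) :=
  hT.comp (continuous_id.finSnoc continuous_const)

/-- **Banach–Steinhaus for multilinear maps (Bourbaki).**  On a finite product of Baire real topological vector spaces
with countably seminormed topologies, a pointwise bounded family of continuous multilinear maps into a normed space is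
bounded by ONE product of continuous seminorms: `‖T k x‖ ≤ C ∏ᵢ (∑_{m ∈ s i} p i m)(x i)` (Bourbaki, EVT III §5,
Banach–Steinhaus for multilinear maps; Rudin, Functional Analysis, Thm. 2.17 for the bilinear case). [folklore] -/
theorem MultilinearMap.exists_seminorm_bound_of_pointwise_bdd (G : Type w) [SeminormedAddCommGroup G]
    [NormedSpace ℝ G] :
    ∀ (n : ℕ) (E : Fin n → Type u) (κ : Fin n → Type v)
      [∀ i, AddCommGroup (E i)] [∀ i, Module ℝ (E i)] [∀ i, TopologicalSpace (E i)]
      [∀ i, IsTopologicalAddGroup (E i)] [∀ i, ContinuousSMul ℝ (E i)] [∀ i, BaireSpace (E i)]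
      [∀ i, Countable (κ i)] (p : ∀ i, SeminormFamily ℝ (E i) (κ i)), (∀ i, WithSeminorms (p i)) →
      ∀ {ι : Type uι} (T : ι → MultilinearMap ℝ E G), (∀ k, Continuous (T k)) →
        (∀ x, ∃ C : ℝ, ∀ k, ‖T k x‖ ≤ C) →
          ∃ (s : ∀ i, Finset (κ i)) (C : ℝ), ∀ k x, ‖T k x‖ ≤ C * ∏ i, (∑ m ∈ s i, p i m) (x i) := by
  intro n
  induction n with
  | zero =>
    intro E κ _ _ _ _ _ _ _ p hp ι T hT hbdd
    obtain ⟨C, hC⟩ := hbdd fun i => Fin.elim0 i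
    refine ⟨fun i => Fin.elim0 i, C, fun k x => ?_⟩
    rw [Finset.univ_eq_empty, Finset.prod_empty, mul_one, Subsingleton.elim x fun i => Fin.elim0 i]
    exact hC k
  | succ n ih =>
    intro E κ _ _ _ _ _ _ _ p hp ι T hT hbdd
    -- notation for the first `n` factors and the last one
    set L := E (Fin.last n) with hL
    -- the inductive bound at a fixed last argument
    have hfix : ∀ y : E (Fin.last n), ∃ (s' : ∀ i : Fin n, Finset (κ i.castSucc)) (C : ℝ),
        ∀ k (x' : ∀ i : Fin n, E i.castSucc), ‖T k (Fin.snoc x' y)‖ ≤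
          C * ∏ i, (∑ m ∈ s' i, p i.castSucc m) (x' i) := by
      intro y
      have h := ih (fun i => E i.castSucc) (fun i => κ i.castSucc) (fun i => p i.castSucc) (fun i => hp i.castSucc)
        (fun k => (LinearMap.applyₗ (R := ℝ) y).compMultilinearMap (T k).curryRight)
        (fun k => by
          simpa only [LinearMap.coe_compMultilinearMap, Function.comp_def, LinearMap.applyₗ_apply_apply,
            MultilinearMap.curryRight_apply] using continuous_comp_snoc_left (hT k) y)
        (fun x' => by
          obtain ⟨C, hC⟩ := hbdd (Fin.snoc x' y)
          exact ⟨C, fun k => by simpa using hC k⟩)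
      obtain ⟨s', C, hC⟩ := h
      exact ⟨s', C, fun k x' => by simpa using hC k x'⟩
    -- the closed sets `A (s', N)`
    set A : (∀ i : Fin n, Finset (κ i.castSucc)) × ℕ → Set (E (Fin.last n)) := fun sN =>
      {y | ∀ k (x' : ∀ i : Fin n, E i.castSucc), ‖T k (Fin.snoc x' y)‖ ≤
        sN.2 * ∏ i, (∑ m ∈ sN.1 i, p i.castSucc m) (x' i)} with hA
    have hAclosed : ∀ sN, IsClosed (A sN) := fun sN => by
      simp only [hA, Set.setOf_forall]
      refine isClosed_iInter fun k => isClosed_iInter fun x' => ?_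
      exact isClosed_le (continuous_norm.comp (continuous_comp_snoc_right (hT k) x')) continuous_const
    have hAcover : ⋃ sN, A sN = univ := by
      refine Set.eq_univ_of_forall fun y => ?_
      obtain ⟨s', C, hC⟩ := hfix y
      refine Set.mem_iUnion.2 ⟨⟨s', ⌈C⌉₊⟩, fun k x' => (hC k x').trans ?_⟩
      exact mul_le_mul_of_nonneg_right (Nat.le_ceil C) (Finset.prod_nonneg fun i _ => apply_nonneg _ _)
    obtain ⟨⟨s', N⟩, y₀, hy₀⟩ := nonempty_interior_of_iUnion_of_closed hAclosed hAcover
    -- a seminorm ball around `y₀` inside `A (s', N)`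
    rw [mem_interior_iff_mem_nhds, (hp (Fin.last n)).mem_nhds_iff] at hy₀
    obtain ⟨sL, r, hr, hball⟩ := hy₀
    set q : Seminorm ℝ (E (Fin.last n)) := ∑ m ∈ sL, p (Fin.last n) m with hq
    set P : (∀ i : Fin n, E i.castSucc) → ℝ := fun x' => ∏ i, (∑ m ∈ s' i, p i.castSucc m) (x' i) with hP
    have hP0 : ∀ x', 0 ≤ P x' := fun x' => Finset.prod_nonneg fun i _ => apply_nonneg _ _
    have hmemA : ∀ z : E (Fin.last n), q z < r → y₀ + z ∈ A (s', N) := fun z hz => by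
      refine hball ?_
      rw [Seminorm.mem_ball, add_sub_cancel_left]
      exact lt_of_le_of_lt (Seminorm.finset_sup_le_sum (p (Fin.last n)) sL z) hz
    have hy₀A : y₀ ∈ A (s', N) := by simpa using hmemA 0 (by rw [map_zero]; exact hr)
    -- the bound on the ball, by additivity in the last slot
    have hsmall : ∀ k x' (z : E (Fin.last n)), q z < r → ‖T k (Fin.snoc x' z)‖ ≤ 2 * (N * P x') := by
      intro k x' z hz
      have h1 : ‖T k (Fin.snoc x' (y₀ + z))‖ ≤ N * P x' := hmemA z hz k x'
      have h2 : ‖T k (Fin.snoc x' y₀)‖ ≤ N * P x' := hy₀A k x'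
      have hadd : T k (Fin.snoc x' (y₀ + z)) = T k (Fin.snoc x' y₀) + T k (Fin.snoc x' z) := by
        have := ((T k).curryRight x').map_add y₀ z
        simpa only [MultilinearMap.curryRight_apply] using this
      have : T k (Fin.snoc x' z) = T k (Fin.snoc x' (y₀ + z)) - T k (Fin.snoc x' y₀) := by
        rw [hadd]; abel
      rw [this]
      exact (norm_sub_le _ _).trans (by linarith)
    -- the bound everywhere, by homogeneity in the last slot
    have hlast : ∀ k x' (y : E (Fin.last n)), ‖T k (Fin.snoc x' y)‖ ≤ (4 * N / r) * P x' * q y := by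
      intro k x' y
      have hsmul : ∀ t : ℝ, T k (Fin.snoc x' (t • y)) = t • T k (Fin.snoc x' y) := fun t => by
        have := ((T k).curryRight x').map_smul t y
        simpa only [MultilinearMap.curryRight_apply] using this
      by_cases hqy : q y = 0
      · -- `T k (snoc x' y) = 0`
        have hzero : ‖T k (Fin.snoc x' y)‖ = 0 := by
          by_contra hne
          have hpos : 0 < ‖T k (Fin.snoc x' y)‖ := lt_of_le_of_ne (norm_nonneg _) (Ne.symm hne)
          set t : ℝ := (2 * (N * P x') + 1) / ‖T k (Fin.snoc x' y)‖ with ht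
          have hty : q (t • y) < r := by rw [map_smul_eq_mul, hqy, mul_zero]; exact hr
          have hb := hsmall k x' (t • y) hty
          rw [hsmul, norm_smul, Real.norm_of_nonneg (by positivity), ht, div_mul_cancel₀ _ hpos.ne'] at hb
          linarith
        rw [hzero, hqy, mul_zero]
      · have hqpos : 0 < q y := lt_of_le_of_ne (apply_nonneg _ _) (Ne.symm hqy)
        set t : ℝ := r / (2 * q y) with ht
        have htpos : 0 < t := by positivity
        have hty : q (t • y) < r := by
          rw [map_smul_eq_mul, Real.norm_of_nonneg htpos.le]
          have : t * q y = r / 2 := by rw [ht]; field_simp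
          rw [this]; linarith
        have hb := hsmall k x' (t • y) hty
        rw [hsmul, norm_smul, Real.norm_of_nonneg htpos.le] at hb
        -- `t ‖T‖ ≤ 2 N P` ⇒ `‖T‖ ≤ 2 N P / t = (4 N / r) P q`
        rw [ht] at hb
        have h2 : ‖T k (Fin.snoc x' y)‖ ≤ 2 * (N * P x') / (r / (2 * q y)) := by
          rw [le_div_iff₀ htpos]; linarith
        calc ‖T k (Fin.snoc x' y)‖ ≤ 2 * (N * P x') / (r / (2 * q y)) := h2
          _ = 4 * N / r * P x' * q y := by field_simp; ring
    -- assemble the seminorm data on `Fin (n + 1)`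
    refine ⟨Fin.snoc (α := fun i : Fin (n + 1) => Finset (κ i)) s' sL, 4 * N / r, fun k x => ?_⟩
    have hx : x = Fin.snoc (Fin.init x) (x (Fin.last n)) := (Fin.snoc_init_self x).symm
    rw [hx, Fin.prod_univ_castSucc]
    simp only [Fin.snoc_castSucc, Fin.snoc_last, Fin.init]
    have h := hlast k (Fin.init x) (x (Fin.last n))
    simp only [hP, hq, Fin.init] at h
    calc ‖T k (Fin.snoc (fun i => x i.castSucc) (x (Fin.last n)))‖
        ≤ 4 * N / r * (∏ i, (∑ m ∈ s' i, p i.castSucc m) (x i.castSucc)) *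
            (∑ m ∈ sL, p (Fin.last n) m) (x (Fin.last n)) := h
      _ = _ := by ring

/-- **Pointwise convergent sequences of multilinear maps converge along convergent arguments.**  In the setting of
`MultilinearMap.exists_seminorm_bound_of_pointwise_bdd`, if `T k x → T∞ x` for every `x` (a SEQUENCE, `k : ℕ`) and
`x k → x₀`, then `T k (x k) → T∞ x₀` (uniform bound + telescoping `MultilinearMap.map_sub_map_piecewise`; Bourbaki,
EVT III §5). [folklore] -/
theorem MultilinearMap.tendsto_apply_of_pointwise_tendsto (G : Type w) [SeminormedAddCommGroup G] [NormedSpace ℝ G]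
    {n : ℕ} {E : Fin n → Type u} {κ : Fin n → Type v}
    [∀ i, AddCommGroup (E i)] [∀ i, Module ℝ (E i)] [∀ i, TopologicalSpace (E i)]
    [∀ i, IsTopologicalAddGroup (E i)] [∀ i, ContinuousSMul ℝ (E i)] [∀ i, BaireSpace (E i)]
    [∀ i, Countable (κ i)] (p : ∀ i, SeminormFamily ℝ (E i) (κ i)) (hp : ∀ i, WithSeminorms (p i))
    (T : ℕ → MultilinearMap ℝ E G) (hT : ∀ k, Continuous (T k)) (Tlim : (∀ i, E i) → G)
    (hconv : ∀ x, Tendsto (fun k => T k x) atTop (𝓝 (Tlim x)))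
    {x : ℕ → ∀ i, E i} {x₀ : ∀ i, E i} (hx : Tendsto x atTop (𝓝 x₀)) :
    Tendsto (fun k => T k (x k)) atTop (𝓝 (Tlim x₀)) := by
  -- pointwise boundedness from pointwise convergence
  have hbdd : ∀ z, ∃ C : ℝ, ∀ k, ‖T k z‖ ≤ C := fun z => by
    obtain ⟨C, hC⟩ := (hconv z).norm.bddAbove_range
    exact ⟨C, fun k => hC ⟨k, rfl⟩⟩
  obtain ⟨s, C, hC⟩ := MultilinearMap.exists_seminorm_bound_of_pointwise_bdd G n E κ p hp T hT hbdd
  -- the bounding seminorms are continuous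
  set Q : ∀ i, Seminorm ℝ (E i) := fun i => ∑ m ∈ s i, p i m with hQ
  have hQc : ∀ i, Continuous (Q i) := fun i =>
    Seminorm.continuous_finsetSum fun m _ => (hp i).continuous_seminorm m
  -- telescoping: `T k (x k) − T k x₀ = Σᵢ T k (g k i)`
  set g : ℕ → Fin n → ∀ j, E j := fun k i j =>
    if j < i then x k j else if i = j then x k j - x₀ j else x₀ j with hg
  set glim : Fin n → ∀ j, E j := fun i j => if j < i then x₀ j else if i = j then x₀ j - x₀ j else x₀ j with hglim
  have htel : ∀ k, T k (x k) - T k x₀ = ∑ i, T k (g k i) := fun k => by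
    have h := (T k).map_sub_map_piecewise (x k) x₀ Finset.univ
    rw [Finset.piecewise_univ] at h
    rw [h]
    refine Finset.sum_congr rfl fun i _ => ?_
    congr 1
    funext j
    simp only [hg, Finset.mem_univ, true_implies]
  have hgt : ∀ i, Tendsto (fun k => g k i) atTop (𝓝 (glim i)) := fun i => by
    rw [tendsto_pi_nhds]
    intro j
    have hxj : Tendsto (fun k => x k j) atTop (𝓝 (x₀ j)) := tendsto_pi_nhds.1 hx j
    simp only [hg, hglim]
    split_ifs
    · exact hxj
    · exact hxj.sub tendsto_const_nhds
    · exact tendsto_const_nhds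
  -- each telescoping term tends to `0`
  have hterm : ∀ i, Tendsto (fun k => T k (g k i)) atTop (𝓝 0) := fun i => by
    have hF : Continuous fun z : ∀ j, E j => ∏ j, Q j (z j) :=
      continuous_finsetProd _ fun j _ => (hQc j).comp (continuous_apply j)
    have hlim0 : ∏ j, Q j (glim i j) = 0 := by
      refine Finset.prod_eq_zero (Finset.mem_univ i) ?_
      simp only [hglim, lt_irrefl, if_false, if_true, sub_self, map_zero]
    have hFt : Tendsto (fun k => C * ∏ j, Q j (g k i j)) atTop (𝓝 0) := by
      have := (hF.tendsto (glim i)).comp (hgt i)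
      rw [hlim0] at this
      simpa using this.const_mul C
    rw [tendsto_zero_iff_norm_tendsto_zero]
    exact squeeze_zero (fun k => norm_nonneg _) (fun k => hC k (g k i)) hFt
  have hdiff : Tendsto (fun k => T k (x k) - T k x₀) atTop (𝓝 0) := by
    simp_rw [htel]
    simpa using tendsto_finsetSum Finset.univ fun i _ => hterm i
  have := hdiff.add (hconv x₀)
  simpa using this

end Literature.Analysis.FunctionSpaces

end
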